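import Summits.CriticalPhenomena.PercolationContinuityZ3.Theorems.Transplant.SkelConcKitsHab
import Summits.CriticalPhenomena.PercolationContinuityZ3.Theorems.Transplant.SkelConcKitsOrthant
import Summits.CriticalPhenomena.PercolationContinuityZ3.Theorems.Transplant.SkelConcRootKits
import Summits.CriticalPhenomena.PercolationContinuityZ3.Theorems.Transplant.SkelHabChainT
import Summits.CriticalPhenomena.PercolationContinuityZ3.Theorems.Transplant.SkelConcReachRun
import Summits.CriticalPhenomena.PercolationContinuityZ3.Theorems.Transplant.SkelConcReachHabFull
import HarnessLib

/-!
# L6 (C), kit clauses — the per-level `hkits` clause of a HABITAT CHAIN step (`Skel.HabChainData`, p2-g4) from the padded cube kits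
# (`SkelI.kitClause_cubeHab_of_sets`, p3-g5): the (C) corridor residue's kit obligation reduced to the input family, the slab/cube constants,
# the planar chain parameters, a FULL habitat below depth `Rw` over `Q_x ∪ H_{x,du}`, a rim beyond depth `Rr`, the subbox weighting and the counts
# (SHEAR-SCOPE §3.11 item 4; HabChainData twin of p2-g5's `Skel.hkits_rootWAD`)

builds on p205010 (kernel theorem, internal audit signed; external expert review pending) — nothing in this file uses p205010.
Lane `prim-bschramm`, seat `prim-bschramm-p3` (gen 5); helper file (`--supports stmt-CriticalPhenomena-4575 --as helper`).

For a habitat chain `P` (window graph `winGraphIn G P.Ω`, planar cells `P.C`, unit `P.t = r/4`, neighbourhood radius `P.R'`, levels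
`[P.j₀, P.j₁]`, step `i ≤ 86`, region `P.stepD Φ i = WinIn Ω (region i)`, target `P.tgtE Φ i = WinIn Ω (core (i+1)) ∪ P.Rim i`):
* the plain window is `(P.root, Rw)` with `hfullW : ∀ Ppl ⊆ C.Q x ∪ C.Hfull x du, Φ.Win P.root Ppl Rw ⊆ P.Ω` (for the fresh habitat `habΩ`:
  p2-g4's `Skel.win_subset_habΩ` with `Rw := E − 3`); the level box of `(i, j)` lies in `region i ⊆ Q_x ∪ H` (`Sched.enlarge_core_subset_region`,
  `Sched.region_subset_Q_union_Hfull`), so `hfull`, `winLevelIn ⊆ stepD ⊆ Ω` follow;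
* levels are `2 T₀` wide as soon as `T₀ = tanOff ℓs M ≤ P.j₀` (cores are nonempty);
* the rim: `hRim : ∀ v ∈ P.stepD Φ i, v ∉ B_G(P.root, Rr) → v ∈ P.Rim i` with `r₀ + Rr ≤ Rw`, `Rr + ψ(6t) + ψ M ≤ Rw` (`Rt := Rw`, `L″ := Rw − Rr`,
  `Ldeep := ψ(6t)`);
* the deep routes: `ChainPlanar.Sched.levelBox_room` at the cube centre's footprint (a point of the shell box, hence of the level box) gives a scale
  `ℓ ∈ [ℓ₀, 6t]` (`M < ℓ₀`, `P.R' + ℓ₀ ≤ P.t`, `[ℓ₀, 6t] ⊆ Ssc`) with `φ(c) + Λ_ℓ ⊆ region i` and an orthant face `φ(c) + F_{a,τ}(ℓ) ⊆ core (i+1)`;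
  deepness `B_G(c, ψ(6t)) ⊆ B_G(root, Rw)` + `hfullW` put the route prism in `stepD i` (`Skel.fatSeq_subset_Win`) and the orthant quarter-piece in
  `tgtT i` (p2-g5's `Skel.macroPiece_orthant_subset_Win`).
Main: **`Skel.HabChainData.hkits_cube`** (§1) and the run-level composition **`Skel.hkitsR_concSG`** (§2): the `hkitsR` premise of p5-g4's
`Skel.reachOblRH_concSG` (`SkelConcReachRun`) in its RIM-COVERING form (the premise may use that `P.Rim i` contains every region vertex beyond
depth `E − L'`; p3-g5 snag note 2026-08-20 22:24Z) for the concentric scheme of record, from the scheme-level constants — `Rw := E − 3`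
(`Skel.win_subset_habΩ`), `Rr := E − L'`, `hWD := Skel.isSubbox_Wcor_hab`; arithmetic `r₀ + 3 ≤ L'`, `ψ(6t) + ψ M + 3 ≤ L' ≤ E₀`; and **`Skel.reachOblRH_concSG_kits`** = p5-g4's `reachOblRH_concSG` with the kit
clauses discharged (its proof verbatim, the premise fed by `hkitsR_concSG`) — the (C) residue of the general node modulo constants.
[cite: KozmaNitzan2024, §4 Lemma 10 Steps III–IV (pp. 19–21), Lemma 11 (pp. 22–23), Lemma 12 (pp. 23–25), p. 30 (Step IV)]
-/

noncomputable section

open MeasureTheory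
open scoped Classical

namespace Summit.CriticalPhenomena.PercolationContinuityZ3.Theorems
namespace Transplant
namespace Skel

open Literature.Probability.Percolation Literature.Probability.LatticeModels SimpleGraph KNLevels KozmaNitzan ChainPlanar
open Literature.Probability.Percolation.GM (HOct)
open Literature.Probability.Percolation.KozmaNitzan.Cells (sgOf sgOf_sign)
open Literature.Barriers.CriticalPhenomena (graphBall graphBall_finite mem_graphBall_self graphBall_mono)
open SkelI (tanOff cubeU)

variable {V : Type} [DecidableEq V] {G : SimpleGraph V} [G.LocallyFinite] (Φ : PlanarSkeletonConc G)

namespace HabChainData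

omit [DecidableEq V] [G.LocallyFinite] in
/-- The planar core of step `i` is the order interval of the level corners. [folklore] -/
theorem pcore_eq_Icc (P : HabChainData V) (i : ℕ) : P.pcore i = Finset.Icc (P.lo i) (P.hi i) := rfl

omit [DecidableEq V] [G.LocallyFinite] in
/-- **The level-`j` planar box of step `i` lies in the planar region `i`** (`j ≤ P.j₁ ≤ P.Rlev`, `P.Rlev + 1 ≤ P.R'`, `100 P.R' ≤ P.t`, `i ≤ 86`).
[cite: KozmaNitzan2024, §4 Lemma 10 (p. 17: B⟨j⟩ ⊆ D)] -/
theorem levelBox_subset_pregion (P : HabChainData V) (hR : 100 * P.R' ≤ P.t) (hRl : P.Rlev + 1 ≤ P.R') (hj : P.j₁ ≤ P.Rlev)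
    {i : ℕ} (hi : i ≤ Sched.nLast) {j : ℕ} (hjj : j ≤ P.j₁) :
    Finset.Icc (P.lo i - (j : Site 2)) (P.hi i + (j : Site 2)) ⊆ P.pregion i := by
  have hjR : (j : ℤ) ≤ P.R' := by exact_mod_cast (hjj.trans hj).trans (by omega : P.Rlev ≤ P.R')
  rw [HabChainData.lo, HabChainData.hi, sBox_enlarge _ _ (sgOf_sign P.du)]
  exact (sBox_mono (sgOf_sign P.du) _ (by linarith) (by linarith) (by linarith)).trans (Sched.enlarge_core_subset_region (sgOf_sign P.du) _ hR hi)

omit [DecidableEq V] in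
/-- **Levels from `T₀` on are `2 T₀` wide** (the core is nonempty). [folklore] -/
theorem levelBox_wide (P : HabChainData V) (hR : 100 * P.R' ≤ P.t) {i : ℕ} (hi : i ≤ Sched.nLast) {ℓs M j : ℕ} (hj : tanOff ℓs M ≤ j) :
    ∀ k, (P.lo i - (j : Site 2)) k + 2 * tanOff ℓs M ≤ (P.hi i + (j : Site 2)) k := by
  intro k
  have hne : (Finset.Icc (P.lo i) (P.hi i)).Nonempty := by
    rw [← pcore_eq_Icc]; exact P.pcore_nonempty hR (by omega)
  have hle := (Finset.nonempty_Icc.1 hne) k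
  have hj' : (tanOff ℓs M : ℤ) ≤ j := by exact_mod_cast hj
  simp only [Pi.sub_apply, Pi.add_apply, Pi.natCast_apply]
  linarith

/-- **THE KIT CLAUSE OF A HABITAT CHAIN STEP** (level `j ∈ [P.j₀, P.j₁]` of step `i ≤ 86`), from the padded cube kits of the plain window
`(P.root, Rw)`: see the module docstring for the hypotheses.  Conclusion = the `hkits` clause of `Skel.HabChainData.kitsAt_stepH` /
`Skel.reachOblAtH_concSG` at `(i, j)`. [cite: KozmaNitzan2024, §4 Lemma 10 Steps III–IV (pp. 19–21), Lemma 12 (pp. 23–25), p. 30] -/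
theorem hkits_cube [Countable V] {p : unitInterval} (hC : Φ.toPlanarSkeleton.CylSubcritical p) (msel : V → ℕ) (P : HabChainData V)
    -- the planar chain parameters
    (hr : P.C.r = 4 * P.t) (hR : 100 * P.R' ≤ P.t) (hRl : P.Rlev + 1 ≤ P.R') (hj : P.j₁ ≤ P.Rlev)
    -- the input family (free margin `a ≤ δ²`) and the scales
    {Ssc : Finset ℕ} {q : unitInterval} {δ a : ℝ} (hδ : 0 < δ) (ha : a ≤ δ ^ 2)
    (hin : ∀ i ∈ Skel.inputIndex Φ Ssc, 1 - a < (bondPercolation G q).real (Skel.inputEvent Φ hC msel i))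
    {M : ℕ} (hM : M ∈ Ssc) (hmsel : ∀ t ∈ Φ.types, msel t ≤ M) {ℓ₀ : ℕ} (hMℓ₀ : M < ℓ₀) (hℓ₀ : P.R' + ℓ₀ ≤ P.t)
    (hSsc : ∀ ℓ, ℓ₀ ≤ ℓ → ℓ ≤ 6 * P.t → ℓ ∈ Ssc)
    -- the slab / cube constants (`T₀ = tanOff ℓs M = 2ℓs + 2 + M`; `Rc` the slab cylinder radius)
    {ℓs Rc r₀ rs : ℕ} (hMℓ : M + 1 ≤ ℓs) (hj₀ : tanOff ℓs M ≤ P.j₀)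
    (hR'₁ : Φ.cylRadMax ℓs (ℓs + 2 + 2 * tanOff ℓs M) ≤ Rc) (hR'₂ : Φ.cylRadMax ℓs (ℓs + 2 + M + fatRadius Φ hC M) ≤ Rc)
    (hr₀₁ : ℓs + 1 + tanOff ℓs M + Rc ≤ r₀) (hr₀₂ : 2 * ℓs + 2 + tanOff ℓs M + M + fatRadius Φ hC M ≤ r₀)
    (hrs₁ : ℓs + 2 + tanOff ℓs M + Rc ≤ rs) (hrs₂ : 2 * ℓs + 3 + tanOff ℓs M + M + fatRadius Φ hC M ≤ rs)
    -- the habitat is full below depth `Rw` over `Q_x ∪ H`; the rim lies beyond depth `Rr`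
    {Rw Rr : ℕ} (hfullW : ∀ Ppl : Finset (Site 2), Ppl ⊆ P.C.Q P.x ∪ P.C.Hfull P.x P.du → Φ.Win P.root Ppl Rw ⊆ P.Ω)
    (hr₀R : r₀ + Rr ≤ Rw) (hRr : Rr + fatRadius Φ hC (6 * P.t) + fatRadius Φ hC M ≤ Rw)
    {i : ℕ} (hi : i ≤ Sched.nLast) (hRim : ∀ v ∈ P.stepD Φ i, v ∉ graphBall G P.root Rr → v ∈ P.Rim i)
    -- the weighting and the counts
    {Wt : Sym2 V → unitInterval} (hWD : IsSubbox (winGraphIn G P.Ω) Wt q (P.stepD Φ i)) (k : ℕ)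
    (hN : k * (Φ.Δ + 1) ^ (2 * rs) ≤ P.N)
    (hk : (1 - (q : ℝ) ^ (1 + Φ.Δ * ((Φ.Δ + 1) ^ Rc + (tanOff ℓs M + 2)) +
      ((Φ.Δ + 1) ^ Rc + (tanOff ℓs M + 2)) * (Φ.Δ + 1) ^ fatRadius Φ hC M)) ^ k ≤ δ)
    {j : ℕ} (hjj : j ∈ Finset.Icc P.j₀ P.j₁) :
    ∃ (σ : SData V) (S : Finset V), SHyp (winLDataIn Φ P.Ω (P.lo i) (P.hi i) P.root P.Sfin) j σ ∧ σ.N ≤ P.N ∧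
      (1 - (q : ℝ) ^ σ.sB) ^ σ.k ≤ δ ∧ S ⊆ (winLDataIn Φ P.Ω (P.lo i) (P.hi i) P.root P.Sfin).X j ∧ S ⊆ P.stepD Φ i ∧
      (∀ x ∈ σ.K, ∀ e ∈ σ.seed x, e ∉ wireSet (↑S : Set V)) ∧ (∀ x ∈ σ.K, σ.face x ⊆ S) ∧
      (∀ x ∈ σ.K, 1 - 3 * δ ≤ (prodBernoulli Wt).real {ω | ∃ u ∈ σ.face x,
        1 - δ < (prodBernoulli (pinW Wt (wireSet (↑S : Set V)) ω)).real
          (⋃ t ∈ P.tgtE Φ i, openConnIn (↑(P.stepD Φ i) : Set V) u t)}) := by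
  have hsg := sgOf_sign P.du
  obtain ⟨hj0, hj1⟩ := Finset.mem_Icc.1 hjj
  -- planar: wide levels, the level box inside the region inside `Q_x ∪ H`
  have hwide := levelBox_wide P hR hi (ℓs := ℓs) (M := M) (hj₀.trans hj0)
  have hregQ : P.pregion i ⊆ P.C.Q P.x ∪ P.C.Hfull P.x P.du := Sched.region_subset_Q_union_Hfull hr hR hi
  have hbox := levelBox_subset_pregion P hR hRl hj hi hj1
  have hfull : winLevel Φ P.root Rw (P.lo i) (P.hi i) j ⊆ P.Ω := hfullW _ (hbox.trans hregQ)
  have hXD : winLevelIn Φ P.Ω (P.lo i) (P.hi i) j ⊆ P.stepD Φ i := Φ.WinIn_mono subset_rfl hbox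
  have hDΩ := P.stepD_subset_Ω Φ i
  -- the rim: `Rt := Rw`, `L″ := Rw − Rr`
  have hRwRr : Rw - (Rw - Rr) = Rr := by omega
  have hTrim : ∀ v ∈ winLevelIn Φ P.Ω (P.lo i) (P.hi i) j, v ∉ graphBall G P.root (Rw - (Rw - Rr)) → v ∈ P.tgtE Φ i := by
    intro v hv hfar
    rw [hRwRr] at hfar
    exact Finset.mem_union_right _ (hRim v (hXD hv) hfar)
  refine SkelI.kitClause_cubeHab_of_sets Φ hC msel hδ ha hin hM hmsel hMℓ hwide hR'₁ hR'₂ hr₀₁ hr₀₂ (by omega) hrs₁ hrs₂ hfull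
    k P.root P.Sfin hWD hXD hDΩ hN hk (Rt := Rw) (L'' := Rw - Rr) (Ldeep := fatRadius Φ hC (6 * P.t)) hTrim (by omega) (by omega)
    (by omega) ?_
  -- the room sets of a deep plain contact
  intro x hx hnear hdeep
  -- the cube centre's footprint lies in the shell box, hence in the level box
  have hcW := SkelI.cube_subset_shellWin Φ hC hwide hr₀₂ (by omega : r₀ ≤ Rw) hx hnear
    ((mem_fatSeq_iff Φ hC).2 (self_mem_cylBall Φ _ M _))
  have hφc : Φ.φ (cubeCtr Φ (SkelI.deepCtr Φ P.root Rw (P.lo i - (j : Site 2)) (P.hi i + (j : Site 2)) ℓs M x) (SkelI.exitDir Φ P.root Rw (P.lo i - (j : Site 2)) (P.hi i + (j : Site 2)) x).1 (SkelI.exitDir Φ P.root Rw (P.lo i - (j : Site 2)) (P.hi i + (j : Site 2)) x).2 ℓs M) ∈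
      Finset.Icc (sLo P.du.1 (sgOf P.du) (P.C.cen P.x) (Sched.coreα P.t P.R' i) (Sched.coreβ P.t P.R' i) (Sched.coreW P.t P.R' i) - ((j : ℕ) : Site 2))
        (sHi P.du.1 (sgOf P.du) (P.C.cen P.x) (Sched.coreα P.t P.R' i) (Sched.coreβ P.t P.R' i) (Sched.coreW P.t P.R' i) + ((j : ℕ) : Site 2)) :=
    SkelI.mem_Icc_of_mem_shell (Φ.mem_Win.1 hcW).2
  obtain ⟨ℓ, hℓ0, hℓ6, hsq, a', τ, hface⟩ := Sched.levelBox_room hR hRl hj hℓ₀ hi j hj1 _ hφc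
  have hℓS : ℓ ∈ Ssc := hSsc ℓ hℓ0 hℓ6
  have hMℓ' : M < ℓ := by omega
  have hψ : fatRadius Φ hC ℓ ≤ fatRadius Φ hC (6 * P.t) := fatRadius_mono Φ hC hℓ6
  have hball : graphBall G (cubeCtr Φ (SkelI.deepCtr Φ P.root Rw (P.lo i - (j : Site 2)) (P.hi i + (j : Site 2)) ℓs M x) (SkelI.exitDir Φ P.root Rw (P.lo i - (j : Site 2)) (P.hi i + (j : Site 2)) x).1 (SkelI.exitDir Φ P.root Rw (P.lo i - (j : Site 2)) (P.hi i + (j : Site 2)) x).2 ℓs M) (fatRadius Φ hC ℓ) ⊆ graphBall G P.root Rw :=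
    (graphBall_mono G _ hψ).trans hdeep
  -- the route prism inside the region
  have hQW : fatSeq Φ hC (cubeCtr Φ (SkelI.deepCtr Φ P.root Rw (P.lo i - (j : Site 2)) (P.hi i + (j : Site 2)) ℓs M x) (SkelI.exitDir Φ P.root Rw (P.lo i - (j : Site 2)) (P.hi i + (j : Site 2)) x).1 (SkelI.exitDir Φ P.root Rw (P.lo i - (j : Site 2)) (P.hi i + (j : Site 2)) x).2 ℓs M) ℓ ⊆ Φ.Win P.root (P.pregion i) Rw :=
    fatSeq_subset_Win Φ hC hball fun y hy => hsq (Finset.mem_image.2 ⟨y, hy, add_comm _ _⟩)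
  have hQD : fatSeq Φ hC (cubeCtr Φ (SkelI.deepCtr Φ P.root Rw (P.lo i - (j : Site 2)) (P.hi i + (j : Site 2)) ℓs M x) (SkelI.exitDir Φ P.root Rw (P.lo i - (j : Site 2)) (P.hi i + (j : Site 2)) x).1 (SkelI.exitDir Φ P.root Rw (P.lo i - (j : Site 2)) (P.hi i + (j : Site 2)) x).2 ℓs M) ℓ ⊆ P.stepD Φ i := fun v hv =>
    (Φ.mem_WinIn).2 ⟨hfullW _ hregQ (hQW hv), (Φ.mem_Win.1 (hQW hv)).2⟩
  -- the orthant quarter-piece inside the next core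
  have hcoreQ : P.pcore (i + 1) ⊆ P.C.Q P.x ∪ P.C.Hfull P.x P.du := (Sched.core_succ_subset_region hsg _ hR hi).trans hregQ
  have hFW : macroPiece Φ (cubeCtr Φ (SkelI.deepCtr Φ P.root Rw (P.lo i - (j : Site 2)) (P.hi i + (j : Site 2)) ℓs M x) (SkelI.exitDir Φ P.root Rw (P.lo i - (j : Site 2)) (P.hi i + (j : Site 2)) x).1 (SkelI.exitDir Φ P.root Rw (P.lo i - (j : Site 2)) (P.hi i + (j : Site 2)) x).2 ℓs M) ℓ (fatRadius Φ hC ℓ) ((Equiv.swap 0 a', fun i => τ (Equiv.swap 0 a' i)) : HOct 2) ⊆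
      Φ.Win P.root (P.pcore (i + 1)) Rw :=
    macroPiece_orthant_subset_Win Φ hball hface
  have hFT : macroPiece Φ (cubeCtr Φ (SkelI.deepCtr Φ P.root Rw (P.lo i - (j : Site 2)) (P.hi i + (j : Site 2)) ℓs M x) (SkelI.exitDir Φ P.root Rw (P.lo i - (j : Site 2)) (P.hi i + (j : Site 2)) x).1 (SkelI.exitDir Φ P.root Rw (P.lo i - (j : Site 2)) (P.hi i + (j : Site 2)) x).2 ℓs M) ℓ (fatRadius Φ hC ℓ) ((Equiv.swap 0 a', fun i => τ (Equiv.swap 0 a' i)) : HOct 2) ⊆ P.tgtE Φ i :=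
    fun v hv => Finset.mem_union_left _ ((Φ.mem_WinIn).2 ⟨hfullW _ hcoreQ (hFW hv), (Φ.mem_Win.1 (hFW hv)).2⟩)
  exact ⟨ℓ, hℓS, hMℓ', hQD, _, hFT⟩

end HabChainData

/-! ## §2 The `hkitsR` premise of `Skel.reachOblRH_concSG` (rim-covering form) for the scheme of record -/

section Run

open Literature.Probability.Percolation.GadgetSystem ProbeHistory HSiteScheme Contour KNCells KNCells.KSchA PlanarSkeletonConc
open BoxProdZ2 (ConcRadiiG nQ nS Erad Frad Erad_mono Frad_succ Frad_le_Erad Erad_add_gap_le_Frad_succ)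

variable (C : PCells) (t : V) (gap gap' : ℕ → ℕ) (E₀ L' : ℕ) (q : unitInterval) (δc : ℝ)

/-- **The per-step kit clauses AT RUN HISTORIES for the concentric scheme of record** — the `hkitsR` premise of `Skel.reachOblRH_concSG`
in rim-covering form: for every run `(ω, n)`, chosen edge `e`, onward direction `du` and every habitat chain record `P` with the run's field
values whose rims contain the region vertices beyond depth `E − L'` (`E = E(nQ_α(y))`), the 8-conjunct clause at every step `i ≤ 86` and level
`j ∈ [j₀, j₁]`, from the input family at `q` (margin `a ≤ δ²`), the scales `[ℓ₀, 6 tp] ⊆ Ssc ∋ M`, the slab/cube constants, the counts and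
`r₀ + 3 ≤ L'`, `ψ(6 tp) + ψ M + 3 ≤ L' ≤ E₀`. [cite: KozmaNitzan2024, §4 Lemma 12 (pp. 23–25), p. 30 (Step IV)] -/
theorem hkitsR_concSG [Countable V] {p : unitInterval} (hC : Φ.toPlanarSkeleton.CylSubcritical p) (msel : V → ℕ)
    {tp R' Rlev N j₀ j₁ : ℕ} (hr : C.r = 4 * tp) (hR : 100 * R' ≤ tp) (hRl : Rlev + 1 ≤ R') (hj : j₁ ≤ Rlev)
    (hΛ : WFS C (concRadiiS C gap gap' E₀ L')) (hφ : Φ.φ t = 0) (hgap : ∀ n, 20 * C.r ≤ gap n) (hLE : L' ≤ E₀)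
    {Ssc : Finset ℕ} {δ a : ℝ} (hδ : 0 < δ) (ha : a ≤ δ ^ 2)
    (hin : ∀ i ∈ Skel.inputIndex Φ Ssc, 1 - a < (bondPercolation G q).real (Skel.inputEvent Φ hC msel i))
    {M : ℕ} (hM : M ∈ Ssc) (hmsel : ∀ t ∈ Φ.types, msel t ≤ M) {ℓ₀ : ℕ} (hMℓ₀ : M < ℓ₀) (hℓ₀ : R' + ℓ₀ ≤ tp)
    (hSsc : ∀ ℓ, ℓ₀ ≤ ℓ → ℓ ≤ 6 * tp → ℓ ∈ Ssc)
    {ℓs Rc r₀ rs : ℕ} (hMℓ : M + 1 ≤ ℓs) (hj₀ : SkelI.tanOff ℓs M ≤ j₀)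
    (hR'₁ : Φ.cylRadMax ℓs (ℓs + 2 + 2 * SkelI.tanOff ℓs M) ≤ Rc) (hR'₂ : Φ.cylRadMax ℓs (ℓs + 2 + M + fatRadius Φ hC M) ≤ Rc)
    (hr₀₁ : ℓs + 1 + SkelI.tanOff ℓs M + Rc ≤ r₀) (hr₀₂ : 2 * ℓs + 2 + SkelI.tanOff ℓs M + M + fatRadius Φ hC M ≤ r₀)
    (hrs₁ : ℓs + 2 + SkelI.tanOff ℓs M + Rc ≤ rs) (hrs₂ : 2 * ℓs + 3 + SkelI.tanOff ℓs M + M + fatRadius Φ hC M ≤ rs)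
    (hr₀L : r₀ + 3 ≤ L') (hψL : fatRadius Φ hC (6 * tp) + fatRadius Φ hC M + 3 ≤ L')
    (k : ℕ) (hN : k * (Φ.Δ + 1) ^ (2 * rs) ≤ N)
    (hk : (1 - (q : ℝ) ^ (1 + Φ.Δ * ((Φ.Δ + 1) ^ Rc + (SkelI.tanOff ℓs M + 2)) +
      ((Φ.Δ + 1) ^ Rc + (SkelI.tanOff ℓs M + 2)) * (Φ.Δ + 1) ^ fatRadius Φ hC M)) ^ k ≤ δ) :
    let S : KSchA V ℕ := SkelConc.concSchemeSG Φ C t (concRadiiS C gap gap' E₀ L') q δc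
    ∀ (ω : BondConfig V) (n : ℕ) (e : Site 2 × MDir),
      (S.astOf₂ G (S.hst₂ G ω n)).st.choice = some e → S.Valid₂ G (S.hst₂ G ω n) e → ∀ du ∈ S.onward G (S.hst₂ G ω n) (tgt e),
      ∀ P : HabChainData V,
      P.Ω = habΩ Φ C t (Λ := concRadiiS C gap gap' E₀ L') q δc (S.hst₂ G ω n) e (S.aOf₂ G (S.hst₂ G ω n) e) du → P.C = C →
      P.x = tgt e → P.du = du → P.root = t → P.Sfin = S.Sx G (S.hst₂ G ω n) e (S.aOf₁ G (S.hst₂ G ω n) e) (S.aOf₂ G (S.hst₂ G ω n) e) du →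
      P.t = tp → P.R' = R' → P.Rlev = Rlev → P.N = N → P.j₀ = j₀ → P.j₁ = j₁ →
      (∀ i, ∀ v ∈ P.stepD Φ i, v ∉ graphBall G t (Erad gap gap' E₀ (nQ (S.aOf₁ G (S.hst₂ G ω n) e) (tgt e)) - L') → v ∈ P.Rim i) →
      ∀ i ≤ ChainPlanar.Sched.nLast, ∀ j ∈ Finset.Icc P.j₀ P.j₁,
      ∃ (σ : KNLevels.SData V) (Sz : Finset V),
      KNLevels.SHyp (winLDataIn Φ P.Ω (P.lo i) (P.hi i) P.root P.Sfin) j σ ∧ σ.N ≤ P.N ∧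
      (1 - (q : ℝ) ^ σ.sB) ^ σ.k ≤ δ ∧ Sz ⊆ (winLDataIn Φ P.Ω (P.lo i) (P.hi i) P.root P.Sfin).X j ∧ Sz ⊆ P.stepD Φ i ∧
      (∀ x ∈ σ.K, ∀ e' ∈ σ.seed x, e' ∉ wireSet (↑Sz : Set V)) ∧ (∀ x ∈ σ.K, σ.face x ⊆ Sz) ∧
      (∀ x ∈ σ.K, 1 - 3 * δ ≤ (prodBernoulli (S.Wcor G (faceDataSG Φ C t (concRadiiS C gap gap' E₀ L')) (S.hst₂ G ω n) e
          (S.aOf₁ G (S.hst₂ G ω n) e) (S.aOf₂ G (S.hst₂ G ω n) e) du)).real {ω' | ∃ u ∈ σ.face x,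
        1 - δ < (prodBernoulli (pinW (S.Wcor G (faceDataSG Φ C t (concRadiiS C gap gap' E₀ L')) (S.hst₂ G ω n) e
          (S.aOf₁ G (S.hst₂ G ω n) e) (S.aOf₂ G (S.hst₂ G ω n) e) du) (wireSet (↑Sz : Set V)) ω')).real
          (⋃ t' ∈ P.tgtE Φ i, openConnIn (↑(P.stepD Φ i) : Set V) u t')}) := by
  intro S ω n e hc hV du hdu P hPΩ hPC hPx hPdu hProot hPS hPt hPR hPRl hPN hPj₀ hPj₁ hRimC i hi j hjj
  obtain ⟨Ω, C', x, du', tp', R'', Rlev', N', j₀', j₁', root, Sfin, Rim⟩ := P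
  simp only at hPΩ hPC hPx hPdu hProot hPS hPt hPR hPRl hPN hPj₀ hPj₁ hRimC hjj ⊢
  subst Ω C' x du' root Sfin tp' R'' Rlev' N' j₀' j₁'
  have hE₀1 : 1 ≤ E₀ := by omega
  -- the schedule's radii at the realised triple (`rQ = E`, `ρ ≡ E − 2`)
  obtain ⟨hEQ0, -, hρ0, -, -, -⟩ := reach_radii_concSG hgap hE₀1 hφ hc hV hdu
  have hEQ : (concRadiiS C gap gap' E₀ L').rQ (S.aOf₁ G (S.hst₂ G ω n) e) (tgt e) =
      Erad gap gap' E₀ (nQ (S.aOf₁ G (S.hst₂ G ω n) e) (tgt e)) := hEQ0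
  have hρ : ∀ ℓ, (concRadiiS C gap gap' E₀ L').ρ (S.aOf₂ G (S.hst₂ G ω n) e) (tgt e) du ℓ =
      Erad gap gap' E₀ (nQ (S.aOf₁ G (S.hst₂ G ω n) e) (tgt e)) - 2 := hρ0
  have hdrift : E₀ + 20 * C.r * nQ (S.aOf₁ G (S.hst₂ G ω n) e) (tgt e) ≤
      Erad gap gap' E₀ (nQ (S.aOf₁ G (S.hst₂ G ω n) e) (tgt e)) := E₀_add_mul_le_Erad gap' E₀ hgap _
  have hEE₀ : E₀ ≤ Erad gap gap' E₀ (nQ (S.aOf₁ G (S.hst₂ G ω n) e) (tgt e)) := le_trans (Nat.le_add_right _ _) hdrift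
  have hr₀R : r₀ + (Erad gap gap' E₀ (nQ (S.aOf₁ G (S.hst₂ G ω n) e) (tgt e)) - L') ≤
      Erad gap gap' E₀ (nQ (S.aOf₁ G (S.hst₂ G ω n) e) (tgt e)) - 3 := by omega
  have hRr : Erad gap gap' E₀ (nQ (S.aOf₁ G (S.hst₂ G ω n) e) (tgt e)) - L' + fatRadius Φ hC (6 * tp) + fatRadius Φ hC M ≤
      Erad gap gap' E₀ (nQ (S.aOf₁ G (S.hst₂ G ω n) e) (tgt e)) - 3 := by omega
  -- the habitat is full below depth `E − 3` over `Q_y ∪ H`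
  have hfullW : ∀ Ppl : Finset (Site 2), Ppl ⊆ C.Q (tgt e) ∪ C.Hfull (tgt e) du →
      Φ.Win t Ppl (Erad gap gap' E₀ (nQ (S.aOf₁ G (S.hst₂ G ω n) e) (tgt e)) - 3) ⊆
        habΩ Φ C t (Λ := concRadiiS C gap gap' E₀ L') q δc (S.hst₂ G ω n) e (S.aOf₂ G (S.hst₂ G ω n) e) du :=
    fun Ppl hP => win_subset_habΩ Φ hP (by rw [hEQ]; omega) (fun ℓ => by rw [hρ ℓ]; omega)
  -- the onward direction is not the way back
  have hdur : du ≠ rev e.2 := by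
    rintro rfl
    obtain ⟨y, hy, hyc⟩ := hV.src_mem
    have h1 := (Finset.mem_filter.1 hdu).2 y hy
    rw [show tgt e + stepVec (rev e.2) = e.1 from tgt_tgt_rev e] at h1
    exact h1 hyc
  -- the record with the run's fields
  set P : HabChainData V := ⟨habΩ Φ C t (Λ := concRadiiS C gap gap' E₀ L') q δc (S.hst₂ G ω n) e (S.aOf₂ G (S.hst₂ G ω n) e) du,
    C, tgt e, du, tp, R', Rlev, N, j₀, j₁, t, S.Sx G (S.hst₂ G ω n) e (S.aOf₁ G (S.hst₂ G ω n) e) (S.aOf₂ G (S.hst₂ G ω n) e) du,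
    Rim⟩ with hPdef
  -- the regions lie in the habitat proper; the corridor law is a subbox weighting of the habitat graph on them
  have hSt := stepsGeomSG Φ C t hΛ (Λ := concRadiiS C gap gap' E₀ L')
  have hDh : P.stepD Φ i ⊆ S.Γ.Q (S.aOf₁ G (S.hst₂ G ω n) e) (tgt e) ∪ S.Γ.Efar (S.aOf₂ G (S.hst₂ G ω n) e) (tgt e) du := by
    intro v hv
    have hvΩ := P.stepD_subset_Ω Φ i hv
    have hvφ : Φ.φ v ∈ C.Q (tgt e) ∪ C.Hfull (tgt e) du := ((Φ.mem_WinIn).1 (P.stepD_subset Φ hr hR hi hv)).2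
    rcases mem_Q_or_Hfull_of_mem_habΩ Φ hdur hvΩ hvφ with hvQ | hvH
    · exact Finset.mem_union_left _ hvQ
    · exact hSt.Hfull_subset _ _ _ _ hV.anch hvH
  have hWD : IsSubbox (winGraphIn G P.Ω) (S.Wcor G (faceDataSG Φ C t (concRadiiS C gap gap' E₀ L')) (S.hst₂ G ω n) e
      (S.aOf₁ G (S.hst₂ G ω n) e) (S.aOf₂ G (S.hst₂ G ω n) e) du) q (P.stepD Φ i) :=
    isSubbox_Wcor_hab (levelGeomSG Φ C t hΛ (Λ := concRadiiS C gap gap' E₀ L')) (qSepGeomSG Φ C t (Λ := concRadiiS C gap gap' E₀ L'))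
      hSt hV hdu hV.anch (P.stepD_subset_Ω Φ i) hDh
  exact HabChainData.hkits_cube Φ hC msel P hr hR hRl hj hδ ha hin hM hmsel hMℓ₀ hℓ₀ hSsc hMℓ hj₀ hR'₁ hR'₂ hr₀₁ hr₀₂ hrs₁ hrs₂
    hfullW hr₀R hRr hi (hRimC i) hWD k hN hk hjj

/-- **RESIDUE (C) AT RUN HISTORIES WITH THE KIT CLAUSES DISCHARGED** (generic node, habitat form): p5-g4's `Skel.reachOblRH_concSG` with its
`hkitsR` premise supplied by `hkitsR_concSG` (the proof is p5-g4's, verbatim, with the habitat chain's rims `WinIn Ω (region i) ∖ B_G(t, E − L')`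
covering the far region vertices by definition).  Remaining hypotheses: the schedule rooms, the count, the uniform excess radius, the input
family, the scales, the slab/cube constants and `r₀ + 3 ≤ L'`, `ψ(6 tp) + ψ M + 3 ≤ L' ≤ E₀`.
[cite: KozmaNitzan2024, §4 Lemma 12 (pp. 23–25), p. 30 (Step IV), p. 31] -/
theorem reachOblRH_concSG_kits [Countable V] {p : unitInterval} (hC : Φ.toPlanarSkeleton.CylSubcritical p) (msel : V → ℕ)
    {tp R' Rlev N j₀ j₁ : ℕ} (hr : C.r = 4 * tp) (hR : 100 * R' ≤ tp) (hRl : Rlev + 1 ≤ R') (hj : j₁ ≤ Rlev)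
    (hΛ : WFS C (concRadiiS C gap gap' E₀ L')) (hφ : Φ.φ t = 0) (hgap : ∀ n, 20 * C.r ≤ gap n) (hE₀ : 44 * C.r + 3 ≤ E₀)
    (hgapL : ∀ ρ, L' ≤ gap ρ) (hLE : L' ≤ E₀)
    {Δ' : ℕ} {δ η : ℝ} (hcount : 1 / (1 - (q : ℝ)) ^ (Δ' * N) ≤ δ * ((Finset.Icc j₀ j₁).card : ℝ)) (hη : η ≤ δ / 2)
    {Rex : ℕ → ℕ}
    (hRex : ∀ R₀' R₁, Rex R₀' ≤ R₁ → ∀ (Rw : ℕ) (D' A' : Finset V), (∀ d ∈ D', d ∈ graphBall G t Rw) →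
      (∀ d ∈ D', ∀ d' ∈ D', Φ.φ d - Φ.φ d' ∈ box 2 (50 * C.r)) → A' ⊆ D' → (∀ a ∈ A', a ∈ graphBall G t R₀') →
        (bondPercolation G q).real (excess G t R₁ D' A') ≤ η)
    (hsch : ∀ g, Rex (Erad gap gap' E₀ g + 1) + L' ≤ Erad gap gap' E₀ (g + 1))
    -- the kit side: input family at `q` (margin `a ≤ δ²`), scales, slab/cube constants, counts
    {Ssc : Finset ℕ} {a : ℝ} (hδ : 0 < δ) (ha : a ≤ δ ^ 2)
    (hin : ∀ i ∈ Skel.inputIndex Φ Ssc, 1 - a < (bondPercolation G q).real (Skel.inputEvent Φ hC msel i))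
    {M : ℕ} (hM : M ∈ Ssc) (hmsel : ∀ t ∈ Φ.types, msel t ≤ M) {ℓ₀ : ℕ} (hMℓ₀ : M < ℓ₀) (hℓ₀ : R' + ℓ₀ ≤ tp)
    (hSsc : ∀ ℓ, ℓ₀ ≤ ℓ → ℓ ≤ 6 * tp → ℓ ∈ Ssc)
    {ℓs Rc r₀ rs : ℕ} (hMℓ : M + 1 ≤ ℓs) (hj₀ : SkelI.tanOff ℓs M ≤ j₀)
    (hR'₁ : Φ.cylRadMax ℓs (ℓs + 2 + 2 * SkelI.tanOff ℓs M) ≤ Rc) (hR'₂ : Φ.cylRadMax ℓs (ℓs + 2 + M + fatRadius Φ hC M) ≤ Rc)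
    (hr₀₁ : ℓs + 1 + SkelI.tanOff ℓs M + Rc ≤ r₀) (hr₀₂ : 2 * ℓs + 2 + SkelI.tanOff ℓs M + M + fatRadius Φ hC M ≤ r₀)
    (hrs₁ : ℓs + 2 + SkelI.tanOff ℓs M + Rc ≤ rs) (hrs₂ : 2 * ℓs + 3 + SkelI.tanOff ℓs M + M + fatRadius Φ hC M ≤ rs)
    (hr₀L : r₀ + 3 ≤ L') (hψL : fatRadius Φ hC (6 * tp) + fatRadius Φ hC M + 3 ≤ L')
    (k : ℕ) (hN : k * (Φ.Δ + 1) ^ (2 * rs) ≤ N)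
    (hk : (1 - (q : ℝ) ^ (1 + Φ.Δ * ((Φ.Δ + 1) ^ Rc + (SkelI.tanOff ℓs M + 2)) +
      ((Φ.Δ + 1) ^ Rc + (SkelI.tanOff ℓs M + 2)) * (Φ.Δ + 1) ^ fatRadius Φ hC M)) ^ k ≤ δ) :
    ReachOblRH G (SkelConc.concSchemeSG Φ C t (concRadiiS C gap gap' E₀ L') q δc) (faceDataSG Φ C t (concRadiiS C gap gap' E₀ L')) Δ' δ := by
  have hkitsR := hkitsR_concSG Φ C t gap gap' E₀ L' q δc hC msel hr hR hRl hj hΛ hφ hgap hLE hδ ha hin hM hmsel hMℓ₀ hℓ₀ hSsc hMℓ hj₀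
    hR'₁ hR'₂ hr₀₁ hr₀₂ hrs₁ hrs₂ hr₀L hψL k hN hk
  intro h e hrun hc hV du hdu
  set S : KSchA V ℕ := SkelConc.concSchemeSG Φ C t (concRadiiS C gap gap' E₀ L') q δc with hSdef
  obtain ⟨ω, n, rfl⟩ := hrun
  have hE₀1 : 1 ≤ E₀ := by omega
  obtain ⟨hEQ0, hBE0, hρ0, -, hM0, hgen0⟩ := reach_radii_concSG hgap hE₀1 hφ hc hV hdu
  have hEQ : (concRadiiS C gap gap' E₀ L').rQ (S.aOf₁ G (S.hst₂ G ω n) e) (tgt e) =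
      Erad gap gap' E₀ (nQ (S.aOf₁ G (S.hst₂ G ω n) e) (tgt e)) := hEQ0
  have hBE : (concRadiiS C gap gap' E₀ L').rB (S.aOf₁ G (S.hst₂ G ω n) e) e.1 e.2 =
      Erad gap gap' E₀ (nQ (S.aOf₁ G (S.hst₂ G ω n) e) (tgt e)) := hBE0
  have hρ : ∀ ℓ, (concRadiiS C gap gap' E₀ L').ρ (S.aOf₂ G (S.hst₂ G ω n) e) (tgt e) du ℓ =
      Erad gap gap' E₀ (nQ (S.aOf₁ G (S.hst₂ G ω n) e) (tgt e)) - 2 := hρ0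
  have hMr : (concRadiiS C gap gap' E₀ L').rM (S.aOf₂ G (S.hst₂ G ω n) e) (tgt e + stepVec du) =
      Frad gap gap' E₀ (nQ (S.aOf₁ G (S.hst₂ G ω n) e) (tgt e) + 1) - L' := hM0
  have hgen : nQ (S.aOf₁ G (S.hst₂ G ω n) e) (tgt e) = nS (S.aOf₁ G (S.hst₂ G ω n) e) e.1 + 1 := hgen0
  have hB : (concRadiiS C gap gap' E₀ L').rB (S.aOf₁ G (S.hst₂ G ω n) e) e.1 e.2 ≤
      Erad gap gap' E₀ (nQ (S.aOf₁ G (S.hst₂ G ω n) e) (tgt e)) := le_of_eq hBE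
  have hρle : ∀ ℓ, (concRadiiS C gap gap' E₀ L').ρ (S.aOf₂ G (S.hst₂ G ω n) e) (tgt e) du ℓ ≤
      Erad gap gap' E₀ (nQ (S.aOf₁ G (S.hst₂ G ω n) e) (tgt e)) := fun ℓ => by rw [hρ ℓ]; exact Nat.sub_le _ _
  have hdur : du ≠ rev e.2 := by
    rintro rfl
    obtain ⟨y, hy, hyc⟩ := hV.src_mem
    have h1 := (Finset.mem_filter.1 hdu).2 y hy
    rw [show tgt e + stepVec (rev e.2) = e.1 from tgt_tgt_rev e] at h1
    exact h1 hyc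
  have hl1 : (tgt e 0).natAbs + (tgt e 1).natAbs ≤ nQ (S.aOf₁ G (S.hst₂ G ω n) e) (tgt e) :=
    l1_tgt_le_nQ (cellGeomSG_anchor Φ C t (concRadiiS C gap gap' E₀ L') q δc) (cellGeomSG_a₀ Φ C t (concRadiiS C gap gap' E₀ L') q δc) _ hc
  have hdrift : E₀ + 20 * C.r * nQ (S.aOf₁ G (S.hst₂ G ω n) e) (tgt e) ≤
      Erad gap gap' E₀ (nQ (S.aOf₁ G (S.hst₂ G ω n) e) (tgt e)) := E₀_add_mul_le_Erad gap' E₀ hgap _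
  have hmul : 20 * C.r * ((tgt e 0).natAbs + (tgt e 1).natAbs) ≤ 20 * C.r * nQ (S.aOf₁ G (S.hst₂ G ω n) e) (tgt e) :=
    Nat.mul_le_mul_left _ hl1
  have hcolQ : 20 * C.r * ((tgt e 0).natAbs + (tgt e 1).natAbs) + 44 * C.r + 1 ≤
      (concRadiiS C gap gap' E₀ L').rQ (S.aOf₁ G (S.hst₂ G ω n) e) (tgt e) := by
    rw [hEQ]; omega
  have hcolρ : ∀ ℓ, 20 * C.r * ((tgt e 0).natAbs + (tgt e 1).natAbs) + 44 * C.r + 1 ≤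
      (concRadiiS C gap gap' E₀ L').ρ (S.aOf₂ G (S.hst₂ G ω n) e) (tgt e) du ℓ := fun ℓ => by
    rw [hρ ℓ]; omega
  have hρM : ∀ ℓ, (concRadiiS C gap gap' E₀ L').ρ (S.aOf₂ G (S.hst₂ G ω n) e) (tgt e) du ℓ + 1 ≤
      (concRadiiS C gap gap' E₀ L').rM (S.aOf₂ G (S.hst₂ G ω n) e) (tgt e + stepVec du) := fun ℓ => by
    rw [hρ ℓ, hMr, Frad_succ]
    have := hgapL (Erad gap gap' E₀ (nQ (S.aOf₁ G (S.hst₂ G ω n) e) (tgt e)))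
    omega
  have hRexE : Rex (Erad gap gap' E₀ (nS (S.aOf₁ G (S.hst₂ G ω n) e) e.1) + 1) ≤
      Erad gap gap' E₀ (nQ (S.aOf₁ G (S.hst₂ G ω n) e) (tgt e)) - L' := by
    refine Nat.le_sub_of_add_le ?_
    rw [hgen]
    exact hsch _
  have hc' : ((S.scheme₂ G).stN n ω).choice = some e := by rw [S.stN_eq₂]; exact hc
  have hdeep := deep_of_run Φ C t gap gap' E₀ L' q δc hΛ hφ hgap hE₀1 ω n hc' hdu (S.aOf₂ G (S.hst₂ G ω n) e)
  -- the habitat chain record: fresh habitat, rims beyond depth `E − L'`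
  let P : HabChainData V :=
    { Ω := habΩ Φ C t (Λ := concRadiiS C gap gap' E₀ L') q δc (S.hst₂ G ω n) e (S.aOf₂ G (S.hst₂ G ω n) e) du, C := C, x := tgt e, du := du,
      t := tp, R' := R', Rlev := Rlev, N := N, j₀ := j₀, j₁ := j₁, root := t,
      Sfin := S.Sx G (S.hst₂ G ω n) e (S.aOf₁ G (S.hst₂ G ω n) e) (S.aOf₂ G (S.hst₂ G ω n) e) du,
      Rim := fun i => (Φ.WinIn (habΩ Φ C t (Λ := concRadiiS C gap gap' E₀ L') q δc (S.hst₂ G ω n) e (S.aOf₂ G (S.hst₂ G ω n) e) du)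
          (ChainPlanar.Sched.region tp R' du.1 (sgOf du) (C.cen (tgt e)) i)).filter
        fun v => v ∉ graphBall G t (Erad gap gap' E₀ (nQ (S.aOf₁ G (S.hst₂ G ω n) e) (tgt e)) - L') }
  have hRimD : ∀ i, P.Rim i ⊆ P.stepD Φ i := fun i => Finset.filter_subset _ _
  have hRimfar : ∀ i, ∀ v ∈ P.Rim i, v ∉ graphBall G t (Erad gap gap' E₀ (nQ (S.aOf₁ G (S.hst₂ G ω n) e) (tgt e)) - L') :=
    fun i v hv => (Finset.mem_filter.1 hv).2
  have hSt := stepsGeomSG Φ C t hΛ (Λ := concRadiiS C gap gap' E₀ L')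
  have hDh : ∀ i ≤ ChainPlanar.Sched.nLast, P.stepD Φ i ⊆
      S.Γ.Q (S.aOf₁ G (S.hst₂ G ω n) e) (tgt e) ∪ S.Γ.Efar (S.aOf₂ G (S.hst₂ G ω n) e) (tgt e) du := by
    intro i hi v hv
    have hvΩ := P.stepD_subset_Ω Φ i hv
    have hvφ : Φ.φ v ∈ C.Q (tgt e) ∪ C.Hfull (tgt e) du := ((Φ.mem_WinIn).1 (P.stepD_subset Φ hr hR hi hv)).2
    rcases mem_Q_or_Hfull_of_mem_habΩ Φ hdur hvΩ hvφ with hvQ | hvH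
    · exact Finset.mem_union_left _ hvQ
    · exact hSt.Hfull_subset _ _ _ _ hV.anch hvH
  have hexc : ∀ i ≤ ChainPlanar.Sched.nLast,
      (prodBernoulli (S.Wcor G (faceDataSG Φ C t (concRadiiS C gap gap' E₀ L')) (S.hst₂ G ω n) e (S.aOf₁ G (S.hst₂ G ω n) e)
        (S.aOf₂ G (S.hst₂ G ω n) e) du)).real (⋃ t' ∈ P.Rim i, openConn t t') ≤ η := by
    intro i hi
    exact real_rim_le_concSG Φ hΛ hV hV.anch hdu hEQ hB hρle hdeep (hRex _) hRexE
      ((hRimD i).trans (P.stepD_subset_Ω Φ i)) ((hRimD i).trans (hDh i hi)) (hRimfar i)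
  -- the kit clauses at this run (rims cover the far region vertices by definition)
  have hkits := hkitsR ω n e hc hV du hdu P rfl rfl rfl rfl rfl rfl rfl rfl rfl rfl rfl rfl
    (fun i v hv hfar => Finset.mem_filter.2 ⟨hv, hfar⟩)
  exact reachOblAtH_concSG Φ hΛ hφ hV hV.anch hdu hdur P rfl rfl rfl rfl rfl rfl hRimD hr hR hRl hj hcolQ hcolρ hρM hcount hkits hη
    hexc

end Run

end Skel
end Transplant
end Summit.CriticalPhenomena.PercolationContinuityZ3.Theorems

end
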